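/- Fleet lead `ym-wcr-19456-p1` (seat g2), route `WeakCouplingRates`, crux `ColdBoxTwoPointFloorW` (stmt-QuantumFields-19608). -/
-- tree-module: Summits.QuantumFields.YangMills.Theorems.WeakCouplingRatesColdBoxGaussTail
import Summits.QuantumFields.YangMills.Theorems.WeakCouplingRatesColdBoxLinkSmall
import Summits.QuantumFields.YangMills.Theorems.WeakCouplingRatesColdBoxForestPoincareLinear
import Summits.QuantumFields.YangMills.Theorems.WeakCouplingRatesColdBoxDirichletLargeField

/-!
# Crux `ColdBoxTwoPointFloorW`, stub `stub_boxGaussianDomination`, brick R5 assembled: the Gaussian mass of the complement of the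
# small-field event `goodT` is exponentially small

Under the reference `gauss3 H = boxDirichlet H ^{⊗3}` the event `goodT H β ε` (the chart configuration `cfgT β H t` has all plaquettes
touching the box of cost `< β^{2ε−1}`) contains the Gaussian small-field region `{∀ c, ∀ p, |s_p(t c)| ≤ R}` as soon as
`3R²/(2β) + 362·m_E³ < β^{2ε−1}`, `m_E = √3·(12H²+2H+1)·R/√(2β) ≤ ¼` (linear forest Poincaré `abs_dirGlue_le_of_sCirc_le`, p458502, puts every
chart coordinate below `m_E`; the cubic remainder of R3 bounds the costs): `smallField_subset_goodT`.  Hence, by the Gaussian large-field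
bound of D1' (`measureReal_boxDirichlet_not_smallField_le`, seat ym-spine-20043-p1, p468673) on each colour,
**`gauss3_real_compl_goodT_le`: `gauss3(goodTᶜ) ≤ 720·(2H+1)⁴·e^{−R²/2}`**.  With `R = β^ε/2` this is `exp(−β^{2ε}/8)`-small.
No sorry; no new definition; standard axioms.  NOT a claim about the mass gap.
-/

set_option autoImplicit false

noncomputable section

open MeasureTheory Finset
open Literature.Probability.LatticeModels (Site)
open Literature.MathematicalPhysics.QuantumLattice
open Literature.MathematicalPhysics.QuantumFieldTheory
open Literature.MathematicalPhysics.QuantumFieldTheory.LatticeMaxwell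
open Literature.MathematicalPhysics.QuantumFieldTheory.AxialGauge

namespace Summit.QuantumFields.YangMills.Theorems.WeakCouplingRates

variable {H : ℕ}

/-- Circulations over all index triples `(x, i, j)` are controlled by those over genuine plaquettes `i < j` (degenerate ones vanish,
reversed ones change sign). -/
theorem abs_sCirc_le_of_forall_zdPlaquette (A : Literature.MathematicalPhysics.QuantumLattice.ZdEdge 4 → ℝ) {R : ℝ} (hR : 0 ≤ R)
    (h : ∀ p : ZdPlaquette 4, |sCirc A (p.1, p.2.1.1, p.2.1.2)| ≤ R) (x : Site 4) (i j : Fin 4) :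
    |sCirc A (x, i, j)| ≤ R := by
  rcases lt_trichotomy i j with hij | rfl | hji
  · exact h (x, ⟨(i, j), hij⟩)
  · have : sCirc A (x, i, i) = 0 := by simp [sCirc]
    rw [this, abs_zero]; exact hR
  · have hswap : sCirc A (x, i, j) = -sCirc A (x, j, i) := by simp only [sCirc]; ring
    rw [hswap, abs_neg]
    exact h (x, ⟨(j, i), hji⟩)

/-- **The Gaussian small-field region lies inside `goodT`.**  If every Dirichlet circulation of every colour is at most `R`, then — by the
linear forest Poincaré inequality and the cubic chart remainder — every plaquette touching the box costs `< β^{2ε−1}` in `cfgT β H t`,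
provided `m_E = √3(12H²+2H+1)R/√(2β) ≤ ¼` and `3R²/(2β) + 362·m_E³ < β^{2ε−1}`. -/
theorem smallField_subset_goodT {β ε R : ℝ} (hβ : 0 < β) (hH : 1 ≤ H) (hR : 0 ≤ R)
    (hmE : Real.sqrt 3 * (12 * (H : ℝ) ^ 2 + 2 * H + 1) * R / Real.sqrt (2 * β) ≤ 1 / 4)
    (hwin : 3 * R ^ 2 / (2 * β) + 362 * (Real.sqrt 3 * (12 * (H : ℝ) ^ 2 + 2 * H + 1) * R / Real.sqrt (2 * β)) ^ 3 < β ^ (2 * ε - 1)) :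
    {t : TSpace H | ∀ c : Fin 3, ∀ p : ZdPlaquette 4, |dirCirc H (p.1, p.2.1.1, p.2.1.2) (t c)| ≤ R} ⊆ goodT H β ε := by
  intro t ht
  simp only [Set.mem_setOf_eq] at ht
  set ρR : ℝ := (12 * (H : ℝ) ^ 2 + 2 * H + 1) * R with hρR
  set mE : ℝ := Real.sqrt 3 * (12 * (H : ℝ) ^ 2 + 2 * H + 1) * R / Real.sqrt (2 * β) with hmEdef
  have hc0 : 0 < Real.sqrt (2 * β) := Real.sqrt_pos.2 (by linarith)
  have hmE0 : 0 ≤ mE := by positivity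
  -- every glued edge value is at most `ρR`
  have hedge : ∀ (c : Fin 3) (e : Literature.MathematicalPhysics.QuantumLattice.ZdEdge 4),
      |dirGlue H (WithLp.ofLp (t c)) e| ≤ ρR := by
    intro c e
    refine abs_dirGlue_le_of_sCirc_le hH (WithLp.ofLp (t c)) (fun x i j => ?_) e
    exact abs_sCirc_le_of_forall_zdPlaquette _ hR (fun p => by rw [← dirCirc_apply]; exact ht c p) x i j
  -- hence every chart coordinate is at most `mE`
  have hcoord : ∀ e, ∑ k, extZero (unscaleT H β t) e k ^ 2 ≤ mE ^ 2 := by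
    intro e
    have hk : ∀ k, extZero (unscaleT H β t) e k ^ 2 ≤ (ρR / Real.sqrt (2 * β)) ^ 2 := by
      intro k
      rw [extZero_unscaleT, div_pow, div_pow]
      refine div_le_div_of_nonneg_right ?_ (by positivity)
      rw [← sq_abs]
      exact pow_le_pow_left₀ (abs_nonneg _) (hedge k e) 2
    calc ∑ k, extZero (unscaleT H β t) e k ^ 2 ≤ ∑ _k : Fin 3, (ρR / Real.sqrt (2 * β)) ^ 2 := Finset.sum_le_sum fun k _ => hk k
      _ = 3 * (ρR / Real.sqrt (2 * β)) ^ 2 := by rw [Finset.sum_const, Finset.card_univ, Fintype.card_fin, nsmul_eq_mul]; norm_num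
      _ = mE ^ 2 := by
          have h3 : Real.sqrt 3 ^ 2 = 3 := Real.sq_sqrt (by norm_num)
          rw [hmEdef, hρR]
          simp only [div_pow, mul_pow, h3]
          ring
  -- Taylor: every plaquette touching the box costs `< β^{2ε−1}`
  rw [goodT, Set.mem_setOf_eq, cfgT, chartCfg_mem_coldGoodSet_iff]
  intro p _
  have hT := abs_plaqCostAt_chartCfg_sub_le (unscaleT H β t) hmE0 hmE hcoord p.1 p.2.1.1 p.2.1.2
  have hquad : ∑ k, (sCirc (fun e => extZero (unscaleT H β t) e k) (p.1, p.2.1.1, p.2.1.2)) ^ 2 ≤ 3 * R ^ 2 / (2 * β) := by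
    have hk : ∀ k, (sCirc (fun e => extZero (unscaleT H β t) e k) (p.1, p.2.1.1, p.2.1.2)) ^ 2 ≤ R ^ 2 / (2 * β) := by
      intro k
      rw [sCirc_extZero_unscaleT, div_pow, Real.sq_sqrt (by linarith : (0 : ℝ) ≤ 2 * β)]
      refine div_le_div_of_nonneg_right ?_ (by linarith)
      rw [← sq_abs]
      exact pow_le_pow_left₀ (abs_nonneg _) (ht k p) 2
    calc ∑ k, (sCirc (fun e => extZero (unscaleT H β t) e k) (p.1, p.2.1.1, p.2.1.2)) ^ 2 ≤ ∑ _k : Fin 3, R ^ 2 / (2 * β) :=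
          Finset.sum_le_sum fun k _ => hk k
      _ = 3 * R ^ 2 / (2 * β) := by rw [Finset.sum_const, Finset.card_univ, Fintype.card_fin, nsmul_eq_mul]; ring
  have := (abs_le.1 hT).2
  linarith

/-- The colour marginals of `gauss3 H` are `boxDirichlet H`. -/
theorem measurePreserving_eval_gauss3 (H : ℕ) (c : Fin 3) :
    MeasurePreserving (fun t : TSpace H => t c) (gauss3 H) (boxDirichlet H) := by
  unfold gauss3; exact measurePreserving_eval _ c

/-- **Gaussian mass of the complement of the small-field region** (three colours): `≤ 3·240(2H+1)⁴e^{−R²/2}`. -/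
theorem gauss3_real_compl_smallField_le (H : ℕ) {R : ℝ} (hR : 0 ≤ R) :
    (gauss3 H).real {t : TSpace H | ∀ c : Fin 3, ∀ p : ZdPlaquette 4, |dirCirc H (p.1, p.2.1.1, p.2.1.2) (t c)| ≤ R}ᶜ ≤
      720 * (2 * (H : ℝ) + 1) ^ 4 * Real.exp (-R ^ 2 / 2) := by
  set B : Set (EuclideanSpace ℝ (DirFree H)) := {s | ¬ ∀ p : ZdPlaquette 4, |dirCirc H (p.1, p.2.1.1, p.2.1.2) s| ≤ R} with hB
  have hcompl : {t : TSpace H | ∀ c : Fin 3, ∀ p : ZdPlaquette 4, |dirCirc H (p.1, p.2.1.1, p.2.1.2) (t c)| ≤ R}ᶜ =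
      ⋃ c : Fin 3, (fun t : TSpace H => t c) ⁻¹' B := by
    ext t
    simp only [hB, Set.mem_compl_iff, Set.mem_setOf_eq, not_forall, Set.mem_iUnion, Set.mem_preimage]
  have hBm : MeasurableSet B := by
    have : MeasurableSet {s : EuclideanSpace ℝ (DirFree H) | ∀ p : ZdPlaquette 4, |dirCirc H (p.1, p.2.1.1, p.2.1.2) s| ≤ R} := by
      have e : {s : EuclideanSpace ℝ (DirFree H) | ∀ p : ZdPlaquette 4, |dirCirc H (p.1, p.2.1.1, p.2.1.2) s| ≤ R} =
          ⋂ p : ZdPlaquette 4, {s | |dirCirc H (p.1, p.2.1.1, p.2.1.2) s| ≤ R} := by ext s; simp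
      rw [e]
      exact MeasurableSet.iInter fun p => measurableSet_le ((measurable_dirCirc _).abs) measurable_const
    rw [hB]
    simpa only [Set.compl_setOf] using this.compl
  rw [hcompl]
  calc (gauss3 H).real (⋃ c : Fin 3, (fun t : TSpace H => t c) ⁻¹' B) ≤ ∑ c : Fin 3, (gauss3 H).real ((fun t : TSpace H => t c) ⁻¹' B) :=
        measureReal_iUnion_fintype_le _
    _ = ∑ _c : Fin 3, (boxDirichlet H).real B :=
        Finset.sum_congr rfl fun c _ => (measurePreserving_eval_gauss3 H c).measureReal_preimage hBm.nullMeasurableSet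
    _ ≤ ∑ _c : Fin 3, 240 * (2 * (H : ℝ) + 1) ^ 4 * Real.exp (-R ^ 2 / 2) :=
        Finset.sum_le_sum fun c _ => measureReal_boxDirichlet_not_smallField_le H hR
    _ = 720 * (2 * (H : ℝ) + 1) ^ 4 * Real.exp (-R ^ 2 / 2) := by
        rw [Finset.sum_const, Finset.card_univ, Fintype.card_fin, nsmul_eq_mul]; ring

/-- **R5: the Gaussian mass of `goodTᶜ` is exponentially small**: under the window of `smallField_subset_goodT`,
`gauss3(goodTᶜ) ≤ 720·(2H+1)⁴·e^{−R²/2}`. -/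
theorem gauss3_real_compl_goodT_le {β ε R : ℝ} (hβ : 0 < β) (hH : 1 ≤ H) (hR : 0 ≤ R)
    (hmE : Real.sqrt 3 * (12 * (H : ℝ) ^ 2 + 2 * H + 1) * R / Real.sqrt (2 * β) ≤ 1 / 4)
    (hwin : 3 * R ^ 2 / (2 * β) + 362 * (Real.sqrt 3 * (12 * (H : ℝ) ^ 2 + 2 * H + 1) * R / Real.sqrt (2 * β)) ^ 3 < β ^ (2 * ε - 1)) :
    (gauss3 H).real (goodT H β ε)ᶜ ≤ 720 * (2 * (H : ℝ) + 1) ^ 4 * Real.exp (-R ^ 2 / 2) :=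
  (measureReal_mono (Set.compl_subset_compl.2 (smallField_subset_goodT hβ hH hR hmE hwin))).trans
    (gauss3_real_compl_smallField_le H hR)

end Summit.QuantumFields.YangMills.Theorems.WeakCouplingRates

end
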